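import Summits.BirchSwinnertonDyer.BirchSwinnertonDyer.Theorems.ClassRecordThreeShimuraKolyvaginOrderBoundAtThreeRungSEmpty
import HarnessLib

/-!
# BC5 rung of the D7-restated crux `ShimuraKolyvaginOrderBoundAtThreeSurj` (the `Surj` slice of
# crux 19616), BY NAME, and the reduction of that crux to its `S ≠ ∅` slice — modulo three published facts

Cell `bsd-stepL` (run/shared/lean/pub/bsd-stepL/), seat `bsd-stepL-shim-p2` (gen 3). Planner decision
D7 (bsd-stepL STATUS 2026-08-26 19:27:12Z / 20:09:54Z; finding of seat shim3b, files
`…ShimuraKolyvaginOrderBoundAtThreeSurjSuffices{,Closes}`): the shared crux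
`ShimuraKolyvaginOrderBoundAtThree` (item stmt-BirchSwinnertonDyer-19616 of routes
`route-BirchSwinnertonDyer-ClassRecordThree` = K2@3 and `route-BirchSwinnertonDyer-KolyvaginRoadThree` =
KOLY) is RESTATED to its `Surj` slice `ShimuraKolyvaginOrderBoundAtThreeSurj` — Kolyvagin's ORDER bound
`#Ш(E/K)[3^∞] ≤ 3^{2·ord_3[E(K):ℤP]}` for displayed points on `X_{N⁺,N⁻}` (`N⁻ = ∏ S`) at
`p = 3 ∣ N⁺`, now under `ρ̄_{E,3}` ONTO (text = old crux with
`Literature.NumberTheory.EllipticCurves.Rank1Residual.Surj W 3 →` inserted after `W.conductorNorm ℤ = N →`).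
It is item stmt-BirchSwinnertonDyer-19899; its registered BC3 skeleton v2 (`plan/D7/skel/Lines-birth-19899-v2.lean`,
sha16 e3c96ff7c4d2a6f7, planner g27 2026-08-26 22:04Z) splits by the 3-ADIC image
(`stub_orderBoundSurj_adicOntoAtThree` / `stub_orderBoundSurj_adicDefectAtThree`) next to a plan-only
BC5 rung at `S = ∅` (the modular curve `X₀(N)`; Cha 2005 Thm. 21 / Matar–Nekovář 2019 Thm. 0.3 + §0.11,
with the index transfer `y_K ↦ P` proved in `…RungSEmpty` for the 19616 rung, landed there as
`ShimuraKolyvaginRungSEmpty.stub_rung_orderBound_SEmptyAtThree{,_of_published}`), displayed with its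
three published-fact binders `gross_zagier`, `kolyvagin`,
`MatarNekovar2019.thm03_padicValNat_card_sha_le_of_irreducible` (conjuncts 1, 2, 19 of the routes' own
`PublishedInputsThree` / `PublishedInputsKolyThree.1`; XL, no `_holds`).

## Contents (theorems only; Theses-free imports; nothing booked)

* §1 `stub_rung_orderBoundSurj_SEmptyAtThree` — the BC5 rung of the RESTATED crux in its own
  vocabulary: the new crux text with `S = ∅ →` inserted after the `Surj` binder, under the three fact
  binders — the REGISTERED rung of skeleton v2, landed BY NAME by this theorem; proof =
  the landed 19616 rung `…RungSEmpty.stub_rung_orderBound_SEmptyAtThree_of_published` (which has no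
  `Surj` binder and is therefore stronger).
* §2 `surjCrux_of_published_of_nonempty` — under the three facts the restated crux FOLLOWS from its
  `S.Nonempty` slice (the genuine Shimura curves `N⁻ > 1`); with the trivial converse
  `surjCrux_nonempty_of`, the restated crux and its `S ≠ ∅` slice are EQUIVALENT modulo print. The
  conclusion of §2 is the text of `Theses.ClassRecordThree.ShimuraKolyvaginOrderBoundAtThreeSurj`
  spelled out (this file imports no `Theses` module, by the cell's standing build rule), so a consumer
  holding the route decl applies it by `Iff.rfl`.

HONEST FRAMING: CONDITIONAL on the three displayed published facts (binders, not proofs); the genuine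
content of the restated crux — the Kolyvagin-system argument on a Shimura curve `X_{N⁺,N⁻}` with
`N⁻ > 1` at a multiplicative `p = 3 ∣ N⁺` (both 3-adic-image stubs) — is untouched and OPEN; BSD is
proved for no curve here. References: [Cha2005] Thm. 21 (p. 173); [MatarNekovar2019] Thm. 0.3, §0.4,
§0.11 (pp. 456–457); [GrossLMS1991] Thm. 1.3; [CaiShuTian2014] Thm. 1.1; [JetchevSkinnerWan2017]
Thm. 4.4.1, §7.4.1.
-/

noncomputable section

open scoped Classical

set_option linter.dupNamespace false

open WeierstrassCurve NumberField Literature.NumberTheory.EllipticCurves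
  Literature.NumberTheory.EllipticCurves.ModularForms
  Literature.NumberTheory.EllipticCurves.Rank1Residual
  Literature.NumberTheory.Automorphic CongruenceSubgroup

namespace Summit.BirchSwinnertonDyer.BirchSwinnertonDyer.Theorems.ShimuraKolyvaginSurjRungSEmpty

open Summit.BirchSwinnertonDyer.BirchSwinnertonDyer.Theorems.ShimuraKolyvaginRungSEmpty

/-! ### §1. The BC5 rung of the restated crux, BY NAME: its own `S = ∅` case (registered form, skeleton v2) -/

/-- **BC5 rung `stub_rung_orderBoundSurj_SEmptyAtThree` of the restated crux
`ShimuraKolyvaginOrderBoundAtThreeSurj`: its own `S = ∅` case (the crux text with `S = ∅ →` inserted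
after the `Surj` binder), from three published facts.** Granted Gross–Zagier (`gross_zagier`),
Kolyvagin's rank-one/finiteness theorem (`kolyvagin`) and the irreducible-image order bound of
Matar–Nekovář 2019 Thm. 0.3 (`= Cha 2005` Thm. 21 on `X₀(N)`): on `X₀(N)` (`S = ∅`, every `ℓ ∣ N` split
in `K`), for `W/ℚ` globally minimal of conductor `N` with `ρ̄_{E,3}` onto, `3 ∣ N` split in `K`, `P₀`
class-minimal for `W`, every non-torsion displayed point `P ∈ E(K)` (Cai–Shu–Tian display) with
`ord_3 degS = ord_3 deg P₀` satisfies `#Ш(E/K)[3^∞] ≤ 3^{2·ord_3[E(K):ℤP]}`. Proof: the landed 19616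
rung `ShimuraKolyvaginRungSEmpty.stub_rung_orderBound_SEmptyAtThree_of_published` (index transfer
`y_K ↦ P` there), which does not even use `Surj` (only `E[3]` irreducible). This is the PRINTED neighbour
S of the restated crux (BC5 witness of weakness); CONDITIONAL on the three displayed facts; nothing
booked. [cite: Cha2005, Thm. 21 (p. 173)] [cite: MatarNekovar2019, Thm. 0.3 (p. 456), §0.4, §0.11 (p. 457)]
[cite: GrossLMS1991, Thm. 1.3] -/
theorem stub_rung_orderBoundSurj_SEmptyAtThree
    (hGZ : ∀ (N : ℕ) [NeZero N] (W : WeierstrassCurve ℚ) (K : Type) [Field K] [NumberField K],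
      gross_zagier N W K)
    (hKol : ∀ (N : ℕ) [NeZero N] (W : WeierstrassCurve ℚ) (K : Type) [Field K] [NumberField K],
      kolyvagin N W K)
    (hMN : ∀ (N : ℕ) [NeZero N] (W : WeierstrassCurve ℚ) (K : Type) [Field K] [NumberField K],
      MatarNekovar2019.thm03_padicValNat_card_sha_le_of_irreducible N W K) :
  ∀ (W : WeierstrassCurve ℚ) [W.IsElliptic] [W.IsGloballyMinimal] (p : ℕ) [Fact p.Prime]
    (N : ℕ) [NeZero N] (K : Type) [Field K] [NumberField K] (S : Finset ℕ)
    (Dt : ModularParametrizationData W N)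
    (X : ShimuraCurveData (∏ q ∈ S, q) (N / ∏ q ∈ S, q))
    (W' : WeierstrassCurve ℚ) [W'.IsElliptic] (P₀ : ShimuraParametrizationData X W'),
    W.conductorNorm ℤ = N → Literature.NumberTheory.EllipticCurves.Rank1Residual.Surj W 3 → S = ∅ →
    p ≠ 2 → W.HasIrreducibleModPGaloisRep p →
    IsImaginaryQuadratic K → Even S.card →
    (∀ ℓ ∈ S, ℓ.Prime ∧ ℓ ∣ N ∧ ¬ ℓ ^ 2 ∣ N ∧
      ((Ideal.span {(ℓ : ℤ)}).primesOver (𝓞 K)).ncard = 1 ∧ ¬ (ℓ : ℤ) ∣ NumberField.discr K) →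
    (∀ ℓ : ℕ, ℓ.Prime → ℓ ∣ N → ℓ ∉ S → ((Ideal.span {(ℓ : ℤ)}).primesOver (𝓞 K)).ncard = 2) →
    ((Ideal.span {(p : ℤ)}).primesOver (𝓞 K)).ncard = 2 →
    P₀.IsMinimalFor W →
    p ∣ N → p = 3 →
    ∀ (P : (W.baseChange K).toAffine.Point) (degS : ℕ), 0 < degS →
      padicValNat p degS = padicValNat p P₀.deg →
      LDerivEK W K =
        8 * (Real.pi : ℂ) ^ 2 * peterssonProduct (Gamma0 N) 2 Dt.f Dt.f /
            ((((Units.torsionOrder K : ℝ) / 2) ^ 2 * √|(NumberField.discr K : ℝ)| : ℝ) : ℂ) *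
          ((P.canonicalHeight : ℂ) / (degS : ℂ)) →
      ¬ IsOfFinAddOrder P →
        Nat.card (AddCommGroup.primaryComponent (W.baseChange K).sha p) ≤
          p ^ (2 * padicValNat p (AddSubgroup.zmultiples P).index) :=
  fun W _ _ p _ N _ K _ _ S Dt X W' _ P₀ hN _ hS ↦
    stub_rung_orderBound_SEmptyAtThree_of_published hGZ hKol hMN W p N K S Dt X W' P₀ hN hS

/-! ### §2. The restated crux reduces to its `S ≠ ∅` slice (the genuine Shimura curves `N⁻ > 1`) -/

/-- **The restated crux `ShimuraKolyvaginOrderBoundAtThreeSurj` from its `S ≠ ∅` slice, under the three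
published facts.** If Gross–Zagier, Kolyvagin and Matar–Nekovář 2019 Thm. 0.3 hold (binders), and
Kolyvagin's order bound `#Ш(E/K)[3^∞] ≤ 3^{2·ord_3[E(K):ℤP]}` holds for displayed points on every
GENUINE Shimura curve `X_{N⁺,N⁻}` of the restated crux (`S` non-empty, i.e. `N⁻ > 1`; hypothesis `hne`
= the crux text with `S.Nonempty →` inserted after the `Surj` binder), then the restated crux holds as
declared, for every even `S`: the case `S = ∅` is the rung §1 (print). The conclusion is, verbatim, the text of the
route decl `Theses.ClassRecordThree.ShimuraKolyvaginOrderBoundAtThreeSurj` (= its `KolyvaginRoadThree`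
copy), so under the routes' published-inputs binder the restated crux and its `N⁻ > 1` slice are
equivalent (converse: `surjCrux_nonempty_of`). CONDITIONAL on the three facts and on the slice `hne`
(statement-shaped: the open content); nothing booked. [cite: Cha2005, Thm. 21 (p. 173)]
[cite: MatarNekovar2019, Thm. 0.3, §0.11 (pp. 456–457)] [cite: JetchevSkinnerWan2017, Thm. 4.4.1] -/
theorem surjCrux_of_published_of_nonempty
    (hGZ : ∀ (N : ℕ) [NeZero N] (W : WeierstrassCurve ℚ) (K : Type) [Field K] [NumberField K],
      gross_zagier N W K)
    (hKol : ∀ (N : ℕ) [NeZero N] (W : WeierstrassCurve ℚ) (K : Type) [Field K] [NumberField K],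
      kolyvagin N W K)
    (hMN : ∀ (N : ℕ) [NeZero N] (W : WeierstrassCurve ℚ) (K : Type) [Field K] [NumberField K],
      MatarNekovar2019.thm03_padicValNat_card_sha_le_of_irreducible N W K)
    (hne : ∀ (W : WeierstrassCurve ℚ) [W.IsElliptic] [W.IsGloballyMinimal] (p : ℕ) [Fact p.Prime]
      (N : ℕ) [NeZero N] (K : Type) [Field K] [NumberField K] (S : Finset ℕ)
      (Dt : ModularParametrizationData W N)
      (X : ShimuraCurveData (∏ q ∈ S, q) (N / ∏ q ∈ S, q))
      (W' : WeierstrassCurve ℚ) [W'.IsElliptic] (P₀ : ShimuraParametrizationData X W'),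
      W.conductorNorm ℤ = N → Surj W 3 → S.Nonempty → p ≠ 2 → W.HasIrreducibleModPGaloisRep p →
      IsImaginaryQuadratic K → Even S.card →
      (∀ ℓ ∈ S, ℓ.Prime ∧ ℓ ∣ N ∧ ¬ ℓ ^ 2 ∣ N ∧
        ((Ideal.span {(ℓ : ℤ)}).primesOver (𝓞 K)).ncard = 1 ∧ ¬ (ℓ : ℤ) ∣ NumberField.discr K) →
      (∀ ℓ : ℕ, ℓ.Prime → ℓ ∣ N → ℓ ∉ S → ((Ideal.span {(ℓ : ℤ)}).primesOver (𝓞 K)).ncard = 2) →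
      ((Ideal.span {(p : ℤ)}).primesOver (𝓞 K)).ncard = 2 →
      P₀.IsMinimalFor W →
      p ∣ N → p = 3 →
      ∀ (P : (W.baseChange K).toAffine.Point) (degS : ℕ), 0 < degS →
        padicValNat p degS = padicValNat p P₀.deg →
        LDerivEK W K =
          8 * (Real.pi : ℂ) ^ 2 * peterssonProduct (Gamma0 N) 2 Dt.f Dt.f /
              ((((Units.torsionOrder K : ℝ) / 2) ^ 2 * √|(NumberField.discr K : ℝ)| : ℝ) : ℂ) *
            ((P.canonicalHeight : ℂ) / (degS : ℂ)) →
        ¬ IsOfFinAddOrder P →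
          Nat.card (AddCommGroup.primaryComponent (W.baseChange K).sha p) ≤
            p ^ (2 * padicValNat p (AddSubgroup.zmultiples P).index)) :
  ∀ (W : WeierstrassCurve ℚ) [W.IsElliptic] [W.IsGloballyMinimal] (p : ℕ) [Fact p.Prime]
    (N : ℕ) [NeZero N] (K : Type) [Field K] [NumberField K] (S : Finset ℕ)
    (Dt : ModularParametrizationData W N)
    (X : ShimuraCurveData (∏ q ∈ S, q) (N / ∏ q ∈ S, q))
    (W' : WeierstrassCurve ℚ) [W'.IsElliptic] (P₀ : ShimuraParametrizationData X W'),
    W.conductorNorm ℤ = N → Surj W 3 → p ≠ 2 → W.HasIrreducibleModPGaloisRep p →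
    IsImaginaryQuadratic K → Even S.card →
    (∀ ℓ ∈ S, ℓ.Prime ∧ ℓ ∣ N ∧ ¬ ℓ ^ 2 ∣ N ∧
      ((Ideal.span {(ℓ : ℤ)}).primesOver (𝓞 K)).ncard = 1 ∧ ¬ (ℓ : ℤ) ∣ NumberField.discr K) →
    (∀ ℓ : ℕ, ℓ.Prime → ℓ ∣ N → ℓ ∉ S → ((Ideal.span {(ℓ : ℤ)}).primesOver (𝓞 K)).ncard = 2) →
    ((Ideal.span {(p : ℤ)}).primesOver (𝓞 K)).ncard = 2 →
    P₀.IsMinimalFor W →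
    p ∣ N → p = 3 →
    ∀ (P : (W.baseChange K).toAffine.Point) (degS : ℕ), 0 < degS →
      padicValNat p degS = padicValNat p P₀.deg →
      LDerivEK W K =
        8 * (Real.pi : ℂ) ^ 2 * peterssonProduct (Gamma0 N) 2 Dt.f Dt.f /
            ((((Units.torsionOrder K : ℝ) / 2) ^ 2 * √|(NumberField.discr K : ℝ)| : ℝ) : ℂ) *
          ((P.canonicalHeight : ℂ) / (degS : ℂ)) →
      ¬ IsOfFinAddOrder P →
        Nat.card (AddCommGroup.primaryComponent (W.baseChange K).sha p) ≤
          p ^ (2 * padicValNat p (AddSubgroup.zmultiples P).index) := by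
  intro W _ _ p _ N _ K _ _ S Dt X W' _ P₀ hN hsurj
  by_cases hS : S = ∅
  · exact stub_rung_orderBoundSurj_SEmptyAtThree hGZ hKol hMN W p N K S Dt X W' P₀ hN hsurj hS
  · exact hne W p N K S Dt X W' P₀ hN hsurj (Finset.nonempty_iff_ne_empty.mpr hS)

/-- **Converse (trivial): the restated crux implies its `S ≠ ∅` slice** — the extra binder
`S.Nonempty` is simply discarded. Together with `surjCrux_of_published_of_nonempty`: modulo the three
published facts, `ShimuraKolyvaginOrderBoundAtThreeSurj` ⟺ its genuine-Shimura-curve slice `N⁻ > 1`.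
[cite: JetchevSkinnerWan2017, Thm. 4.4.1] -/
theorem surjCrux_nonempty_of
    (hKO : ∀ (W : WeierstrassCurve ℚ) [W.IsElliptic] [W.IsGloballyMinimal] (p : ℕ) [Fact p.Prime]
      (N : ℕ) [NeZero N] (K : Type) [Field K] [NumberField K] (S : Finset ℕ)
      (Dt : ModularParametrizationData W N)
      (X : ShimuraCurveData (∏ q ∈ S, q) (N / ∏ q ∈ S, q))
      (W' : WeierstrassCurve ℚ) [W'.IsElliptic] (P₀ : ShimuraParametrizationData X W'),
      W.conductorNorm ℤ = N → Surj W 3 → p ≠ 2 → W.HasIrreducibleModPGaloisRep p →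
      IsImaginaryQuadratic K → Even S.card →
      (∀ ℓ ∈ S, ℓ.Prime ∧ ℓ ∣ N ∧ ¬ ℓ ^ 2 ∣ N ∧
        ((Ideal.span {(ℓ : ℤ)}).primesOver (𝓞 K)).ncard = 1 ∧ ¬ (ℓ : ℤ) ∣ NumberField.discr K) →
      (∀ ℓ : ℕ, ℓ.Prime → ℓ ∣ N → ℓ ∉ S → ((Ideal.span {(ℓ : ℤ)}).primesOver (𝓞 K)).ncard = 2) →
      ((Ideal.span {(p : ℤ)}).primesOver (𝓞 K)).ncard = 2 →
      P₀.IsMinimalFor W →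
      p ∣ N → p = 3 →
      ∀ (P : (W.baseChange K).toAffine.Point) (degS : ℕ), 0 < degS →
        padicValNat p degS = padicValNat p P₀.deg →
        LDerivEK W K =
          8 * (Real.pi : ℂ) ^ 2 * peterssonProduct (Gamma0 N) 2 Dt.f Dt.f /
              ((((Units.torsionOrder K : ℝ) / 2) ^ 2 * √|(NumberField.discr K : ℝ)| : ℝ) : ℂ) *
            ((P.canonicalHeight : ℂ) / (degS : ℂ)) →
        ¬ IsOfFinAddOrder P →
          Nat.card (AddCommGroup.primaryComponent (W.baseChange K).sha p) ≤
            p ^ (2 * padicValNat p (AddSubgroup.zmultiples P).index)) :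
  ∀ (W : WeierstrassCurve ℚ) [W.IsElliptic] [W.IsGloballyMinimal] (p : ℕ) [Fact p.Prime]
    (N : ℕ) [NeZero N] (K : Type) [Field K] [NumberField K] (S : Finset ℕ)
    (Dt : ModularParametrizationData W N)
    (X : ShimuraCurveData (∏ q ∈ S, q) (N / ∏ q ∈ S, q))
    (W' : WeierstrassCurve ℚ) [W'.IsElliptic] (P₀ : ShimuraParametrizationData X W'),
    W.conductorNorm ℤ = N → Surj W 3 → S.Nonempty → p ≠ 2 → W.HasIrreducibleModPGaloisRep p →
    IsImaginaryQuadratic K → Even S.card →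
    (∀ ℓ ∈ S, ℓ.Prime ∧ ℓ ∣ N ∧ ¬ ℓ ^ 2 ∣ N ∧
      ((Ideal.span {(ℓ : ℤ)}).primesOver (𝓞 K)).ncard = 1 ∧ ¬ (ℓ : ℤ) ∣ NumberField.discr K) →
    (∀ ℓ : ℕ, ℓ.Prime → ℓ ∣ N → ℓ ∉ S → ((Ideal.span {(ℓ : ℤ)}).primesOver (𝓞 K)).ncard = 2) →
    ((Ideal.span {(p : ℤ)}).primesOver (𝓞 K)).ncard = 2 →
    P₀.IsMinimalFor W →
    p ∣ N → p = 3 →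
    ∀ (P : (W.baseChange K).toAffine.Point) (degS : ℕ), 0 < degS →
      padicValNat p degS = padicValNat p P₀.deg →
      LDerivEK W K =
        8 * (Real.pi : ℂ) ^ 2 * peterssonProduct (Gamma0 N) 2 Dt.f Dt.f /
            ((((Units.torsionOrder K : ℝ) / 2) ^ 2 * √|(NumberField.discr K : ℝ)| : ℝ) : ℂ) *
          ((P.canonicalHeight : ℂ) / (degS : ℂ)) →
      ¬ IsOfFinAddOrder P →
        Nat.card (AddCommGroup.primaryComponent (W.baseChange K).sha p) ≤
          p ^ (2 * padicValNat p (AddSubgroup.zmultiples P).index) :=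
  fun W _ _ p _ N _ K _ _ S Dt X W' _ P₀ hN hsurj _ ↦ hKO W p N K S Dt X W' P₀ hN hsurj

end Summit.BirchSwinnertonDyer.BirchSwinnertonDyer.Theorems.ShimuraKolyvaginSurjRungSEmpty

end
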